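import Summits.QuantumAdvantage.QuantumAdvantage.Theorems.CubicForrelationNearExactIsExactTwelveLevelFive930Granular

/-!
# Crux `CubicForrelation.NearExactIsExact` (stmt-QuantumAdvantage-14043) — n = 12: granularity of the hyperplane character sums, power-of-two
  refinement (`m ∈ {0, ±16, ±32}`)

Certificate seat `b2b-cforr-cert` (gen 20).  HONEST FRAMING: an elementary corollary (standard axioms) of …TwelveLevelFive930Granular for the
level-5 analysis AT `Φ = 930/1024` (HOME/b2b-cforr-cert-g20/PROOF-N12-930-L5.md); finite-slice infrastructure, NOT summit progress, NO new value
of `θ₁₂` claimed here.  With `Ŝ = 64m`: `Ŝ² = 2048·S_R`, `S_R ∈ {0, #R}` (`gr20_Shat_sq`, `gr20_SR_sq`), `#R ≥ 512` (`gr20_radical_ge`), and `R`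
is a subgroup of `𝔽₂¹²` so `#R · #R^⊥ = 4096` (`card_mul_card_perp`) makes `#R ∈ {512, 1024, 2048}`; `64² m² = 2048·#R` then gives
`m² ∈ {256, 512, 1024}`, and `512` is not a square: `m(y) ∈ {0, ±16, ±32}`.

References: MacWilliams–Sloane (1977) Ch. 15 §2; C. Carlet (2021) §5.2.  Everything below is proved from Mathlib and the tree; axioms are the
standard three.
-/

set_option linter.dupNamespace false -- D-0017: single-problem summit ⇒ `QuantumAdvantage.QuantumAdvantage` by design

noncomputable section

namespace Summit.QuantumAdvantage.QuantumAdvantage.Theorems.CubicForrelation.NearExactIsExact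

open Finset
open Literature.Computability.QuantumComplexity
open Literature.Computability.QuantumComplexity.BuzetChailloux (bxor zeroVec bxor_bxor_cancel_left bxor_zeroVec zeroVec_bxor bxor_comm
  bxor_self twist_zeroVec_right twist_bxor_right)
open Literature.Computability.QuantumComplexity.DerivativeWalsh (W sum_W_sq twist_bxor_left card_mul_card_perp)
open Literature.Computability.QuantumComplexity.Simon (twist_eq_one_or twist_mul_self)

/-! ### Granularity with the power-of-two refinement -/

/-- **`m ∈ {0, ±16, ±32}`**: under the hypotheses of `gr20_hyperplane_granular`, with `Ŝ = 64m`, every `m(y)` is `0`, `±16` or `±32`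
(`Ŝ² = 64²m² = 2048·#R` and `#R ∈ {512, 1024, 2048}` is a power of two, `R` being a subgroup; `m² = 512` has no integer solution).
[this work] -/
theorem gr20_hyperplane_granular_m16 (D : (Fin (6 + 6) → Bool) → Bool) (hD : IsDegLeFun 2 D) (γ : Fin (6 + 6) → Bool) (hγ : γ ≠ zeroVec)
    (t : ℝ) (ht : t = 1 ∨ t = -1)
    (H8 : ∀ x : Fin (6 + 6) → Bool, twist γ x = t → ∀ a b c d : Fin (6 + 6) → Bool, twist γ a = 1 → twist γ b = 1 → twist γ c = 1 →
      twist γ d = 1 → (8 : ℤ) ∣ ∑ ε : Fin 4 → Bool, sZ (D (fun j => x j ^^ decide (Odd #(univ.filter fun i =>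
        ε i && (![a, b, c, d] : Fin 4 → Fin (6 + 6) → Bool) i j)))))
    (m : (Fin (6 + 6) → Bool) → ℤ)
    (hm : ∀ y, ∑ x ∈ univ.filter (fun x : Fin (6 + 6) → Bool => twist γ x = t), (sZ (D x) : ℝ) * twist x y = 64 * (m y : ℝ))
    (y : Fin (6 + 6) → Bool) : m y = 0 ∨ |m y| = 16 ∨ |m y| = 32 := by
  classical
  set V := univ.filter (fun a : Fin (6 + 6) → Bool => twist γ a = 1) with hVdef
  set P := univ.filter (fun x : Fin (6 + 6) → Bool => twist γ x = t) with hPdef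
  set R := V.filter (fun a => ∀ v ∈ V, (D zeroVec ^^ D a ^^ D v ^^ D (bxor a v)) = false) with hRdef
  have hVmem : ∀ a, a ∈ V ↔ twist γ a = 1 := fun a => by rw [hVdef, mem_filter]; simp
  have hPmem : ∀ x, x ∈ P ↔ twist γ x = t := fun x => by rw [hPdef, mem_filter]; simp
  have hVadd : ∀ x ∈ V, ∀ y ∈ V, bxor x y ∈ V := by
    intro x hx y hy; rw [hVmem] at hx hy ⊢; rw [twist_bxor_right, hx, hy, mul_one]
  have hV0 : zeroVec ∈ V := (hVmem _).2 (twist_zeroVec_right γ)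
  have hPV : ∀ x ∈ P, ∀ v ∈ V, bxor x v ∈ P := by
    intro x hx v hv; rw [hPmem] at hx ⊢; rw [hVmem] at hv; rw [twist_bxor_right, hx, hv, mul_one]
  have hVcard : #V = 2048 := tw59_card_half γ hγ 1 (Or.inl rfl)
  have hPcard : #P = 2048 := tw59_card_half γ hγ t ht
  obtain ⟨x₀, hx₀⟩ : P.Nonempty := card_pos.1 (by rw [hPcard]; norm_num)
  have hRge : 512 ≤ #R := gr20_radical_ge D hD γ hγ t ht H8
  have h1 := gr20_Shat_sq D hD P V R γ t hPmem hVmem x₀ hx₀ hPV hPcard hRdef y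
  have h2 := gr20_SR_sq D hD V R hVadd x₀ hRdef y
  -- `R` is a subgroup, so `#R` is a power of two
  have hRmem : ∀ a, a ∈ R ↔ a ∈ V ∧ ∀ v ∈ V, (D zeroVec ^^ D a ^^ D v ^^ D (bxor a v)) = false := fun a => by
    rw [hRdef, mem_filter]
  have hR0 : zeroVec ∈ R := (hRmem _).2 ⟨hV0, fun v _ => by rw [zeroVec_bxor]; cases D zeroVec <;> cases D v <;> rfl⟩
  have hRadd : ∀ a ∈ R, ∀ b ∈ R, bxor a b ∈ R := by
    intro a ha b hb
    rw [hRmem] at ha hb ⊢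
    refine ⟨hVadd a ha.1 b hb.1, fun v hv => ?_⟩
    rw [es_B_add_left D hD a b v, ha.2 v hv, hb.2 v hv]; rfl
  have hRpow : ∃ j, j ≤ 12 ∧ #R = 2 ^ j := by
    have h := card_mul_card_perp (n := 6 + 6) hR0 hRadd
    have hdvd : #R ∣ 2 ^ 12 := by
      refine ⟨#(univ.filter fun y : Fin (6 + 6) → Bool => ∀ x ∈ R, twist x y = 1), ?_⟩
      have : ((#R * #(univ.filter fun y : Fin (6 + 6) → Bool => ∀ x ∈ R, twist x y = 1) : ℕ) : ℝ) = (2 : ℝ) ^ 12 := by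
        push_cast; exact h.trans (by norm_num)
      exact_mod_cast this.symm
    exact (Nat.dvd_prime_pow Nat.prime_two).1 hdvd
  have hRle : #R ≤ 2048 := by
    have : R ⊆ V := by rw [hRdef]; exact filter_subset _ _
    exact hVcard ▸ card_le_card this
  -- the value of `m y`
  have e : ∑ x ∈ P, signOf (D x) * twist x y = 64 * (m y : ℝ) := by
    rw [← hm y]; exact sum_congr rfl fun x _ => by rw [tp_sZ_cast]
  rw [e] at h1
  set Tm := ∑ t ∈ R, signOf (D x₀) * signOf (D (bxor x₀ t)) * twist t y with hTdef
  have hT : Tm = 0 ∨ Tm = #R := by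
    have : Tm * (Tm - #R) = 0 := by rw [mul_sub, ← sq, h2]; ring
    rcases mul_eq_zero.1 this with h | h
    · exact Or.inl h
    · exact Or.inr (by linarith)
  rcases hT with hT0 | hTR
  · left
    rw [hT0, mul_zero] at h1
    have : (m y : ℝ) = 0 := by nlinarith
    exact_mod_cast this
  · right
    rw [hTR] at h1
    obtain ⟨j, hj12, hjR⟩ := hRpow
    -- `2 m² = #R = 2^j` with `9 ≤ j ≤ 11`
    have hmsq : 2 * (m y) ^ 2 = 2 ^ j := by
      have : (2 : ℝ) * (m y : ℝ) ^ 2 = (#R : ℝ) := by nlinarith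
      rw [hjR] at this
      exact_mod_cast this
    have hj9 : 9 ≤ j := by
      by_contra hj; push Not at hj
      have : 2 ^ j ≤ 2 ^ 8 := Nat.pow_le_pow_right (by norm_num) (by omega)
      rw [← hjR] at this; omega
    have hj11 : j ≤ 11 := by
      by_contra hj; push Not at hj
      have : 2 ^ 12 ≤ 2 ^ j := Nat.pow_le_pow_right (by norm_num) (by omega)
      rw [← hjR] at this; omega
    interval_cases j
    · left
      have h256 : (m y) ^ 2 = 16 ^ 2 := by norm_num at hmsq; linarith
      rcases sq_eq_sq_iff_eq_or_eq_neg.1 h256 with h | h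
      · rw [h]; norm_num
      · rw [h]; norm_num
    · exfalso
      have h512 : (m y) ^ 2 = 512 := by norm_num at hmsq; linarith
      have hle : |m y| ≤ 23 := by nlinarith [sq_abs (m y), abs_nonneg (m y)]
      have hge : 22 ≤ |m y| := by nlinarith [sq_abs (m y), abs_nonneg (m y)]
      have hsq := sq_abs (m y)
      rw [h512] at hsq
      interval_cases |m y| <;> omega
    · right
      have h1024 : (m y) ^ 2 = 32 ^ 2 := by norm_num at hmsq; linarith
      rcases sq_eq_sq_iff_eq_or_eq_neg.1 h1024 with h | h
      · rw [h]; norm_num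
      · rw [h]; norm_num

end Summit.QuantumAdvantage.QuantumAdvantage.Theorems.CubicForrelation.NearExactIsExact

end
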